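import Summits.QuantumFields.GaugeBoot.FluctuationVanishing
import Mathlib.RingTheory.PowerSeries.Trunc
import Mathlib.Topology.Algebra.Polynomial
import Mathlib.Algebra.Polynomial.Div
import HarnessLib

/-!
# Fluctuations of Wilson loops, XII: asymptotic expansions in `1/N` (gauge-boot, ADDENDUM 32 part L)

HONEST FRAMING (cell `pub-gaugeboot`, page 1 of every file): the venture produces certified bounds
on lattice expectations at stated coupling, gauge group, dimension and torus size; NOT a mass gap,
NOT a continuum limit, NOT a string tension; NOT Yang–Mills-summit-bearing (barriers
`FixedCouplingUltralocality`, `PerturbativeInvisibility`).  Strong-coupling `SO(N)` lattice gauge theory with free boundary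
condition (S. Chatterjee, Comm. Math. Phys. **366** (2019); S. Chatterjee, J. Jafarov, arXiv:1604.04777); nothing about
four-dimensional continuum Yang–Mills or a mass gap.

## Content

A sequence `a : ℕ → ℝ` HAS THE EXPANSION `A ∈ ℝ⟦X⟧` TO ORDER `K` when `N^K (a_N − Σ_{i≤K} coeff_i A · N^{−i}) → 0`; the
partial sum is `(trunc (K+1) A).eval (1/N)` (`eval_trunc_eq_sum`).  This is preserved by differences and — the one real
lemma — by PRODUCTS (`hasExp_mul`: the truncations multiply correctly modulo `X^{K+1}`), hence by the first-block recursion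
of centered block products (`centered_hasExp`: the finite-`N` centered products, built from `φ_{Λ_N,N,β}`, expand with the
power-series centered products of parts D–K as coefficient series); and the leading coefficient is the rescaled limit
(`tendsto_leading_of_hasExp`).

Everything is `[folklore]` asymptotic bookkeeping.
-/

noncomputable section

open Finset Filter Topology PowerSeries
open Literature.MathematicalPhysics.QuantumFieldTheory.Chatterjee2019LargeN

namespace Summit.QuantumFields.GaugeBoot

namespace StringDuality

variable {d : ℕ}

/-! ## Truncations evaluated at `1/N` -/

/-- `(trunc (K+1) A)(y) = Σ_{i ≤ K} coeff_i A · y^i`. [folklore] -/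
theorem eval_trunc_eq_sum (n : ℕ) (A : PowerSeries ℝ) (y : ℝ) :
    (trunc n A).eval y = ∑ i ∈ Finset.range n, coeff i A * y ^ i := by
  rw [Polynomial.eval]
  exact eval₂_trunc_eq_sum_range y (RingHom.id ℝ) n A

/-- The expansion property is preserved by differences. [folklore] -/
theorem hasExp_sub {K : ℕ} {a b : ℕ → ℝ} {A B : PowerSeries ℝ}
    (ha : Tendsto (fun N : ℕ => (N : ℝ) ^ K * (a N - (trunc (K + 1) A).eval ((1 : ℝ) / N))) atTop (𝓝 0))
    (hb : Tendsto (fun N : ℕ => (N : ℝ) ^ K * (b N - (trunc (K + 1) B).eval ((1 : ℝ) / N))) atTop (𝓝 0)) :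
    Tendsto (fun N : ℕ => (N : ℝ) ^ K * ((a N - b N) - (trunc (K + 1) (A - B)).eval ((1 : ℝ) / N))) atTop (𝓝 0) := by
  have h := ha.sub hb
  rw [sub_zero] at h
  refine h.congr fun N => ?_
  rw [map_sub, Polynomial.eval_sub]
  ring

/-- ★ The expansion property is preserved by PRODUCTS (the coefficient series multiply). [folklore] -/
theorem hasExp_mul {K : ℕ} {a b : ℕ → ℝ} {A B : PowerSeries ℝ}
    (ha : Tendsto (fun N : ℕ => (N : ℝ) ^ K * (a N - (trunc (K + 1) A).eval ((1 : ℝ) / N))) atTop (𝓝 0))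
    (hb : Tendsto (fun N : ℕ => (N : ℝ) ^ K * (b N - (trunc (K + 1) B).eval ((1 : ℝ) / N))) atTop (𝓝 0)) :
    Tendsto (fun N : ℕ => (N : ℝ) ^ K * ((a N * b N) - (trunc (K + 1) (A * B)).eval ((1 : ℝ) / N))) atTop (𝓝 0) := by
  -- the polynomial `trunc A · trunc B − trunc (A·B)` is divisible by `X^{K+1}`
  set Q : Polynomial ℝ := trunc (K + 1) A * trunc (K + 1) B - trunc (K + 1) (A * B) with hQ
  have hdvd : (Polynomial.X : Polynomial ℝ) ^ (K + 1) ∣ Q := by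
    refine Polynomial.X_pow_dvd_iff.mpr fun i hi => ?_
    rw [hQ, Polynomial.coeff_sub, ← Polynomial.coeff_coe, Polynomial.coe_mul,
      ← coeff_mul_eq_coeff_trunc_mul_trunc A B hi, coeff_trunc, if_pos hi, sub_self]
  obtain ⟨Q', hQ'⟩ := hdvd
  have hinv : Tendsto (fun N : ℕ => (1 : ℝ) / N) atTop (𝓝 0) := tendsto_one_div_atTop_nhds_zero_nat
  have hTA : Tendsto (fun N : ℕ => (trunc (K + 1) A).eval ((1 : ℝ) / N)) atTop (𝓝 ((trunc (K + 1) A).eval 0)) :=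
    ((trunc (K + 1) A).continuous.tendsto 0).comp hinv
  have hTB : Tendsto (fun N : ℕ => (trunc (K + 1) B).eval ((1 : ℝ) / N)) atTop (𝓝 ((trunc (K + 1) B).eval 0)) :=
    ((trunc (K + 1) B).continuous.tendsto 0).comp hinv
  have hQ'c : Tendsto (fun N : ℕ => Q'.eval ((1 : ℝ) / N)) atTop (𝓝 (Q'.eval 0)) := (Q'.continuous.tendsto 0).comp hinv
  -- the remainder of `b` tends to zero
  have hs0 : Tendsto (fun N : ℕ => b N - (trunc (K + 1) B).eval ((1 : ℝ) / N)) atTop (𝓝 0) := by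
    have hb' := (hinv.pow K).mul hb
    rw [mul_zero] at hb'
    refine hb'.congr' ?_
    filter_upwards [eventually_gt_atTop 0] with N hN
    have hN : (N : ℝ) ≠ 0 := by exact_mod_cast hN.ne'
    have h1 : ((1 : ℝ) / N) ^ K * (N : ℝ) ^ K = 1 := by rw [← mul_pow, one_div_mul_cancel hN, one_pow]
    rw [← mul_assoc, h1, one_mul]
  -- assemble
  have hlim : Tendsto (fun N : ℕ => ((1 : ℝ) / N) * Q'.eval ((1 : ℝ) / N)
      + (trunc (K + 1) A).eval ((1 : ℝ) / N) * ((N : ℝ) ^ K * (b N - (trunc (K + 1) B).eval ((1 : ℝ) / N)))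
      + ((N : ℝ) ^ K * (a N - (trunc (K + 1) A).eval ((1 : ℝ) / N))) * (trunc (K + 1) B).eval ((1 : ℝ) / N)
      + ((N : ℝ) ^ K * (a N - (trunc (K + 1) A).eval ((1 : ℝ) / N))) * (b N - (trunc (K + 1) B).eval ((1 : ℝ) / N))) atTop
      (𝓝 (0 * Q'.eval 0 + (trunc (K + 1) A).eval 0 * 0 + 0 * (trunc (K + 1) B).eval 0 + 0 * 0)) :=
    (((hinv.mul hQ'c).add (hTA.mul hb)).add (ha.mul hTB)).add (ha.mul hs0)
  simp only [zero_mul, mul_zero, add_zero] at hlim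
  refine hlim.congr' ?_
  filter_upwards [eventually_gt_atTop 0] with N hN
  have hN : (N : ℝ) ≠ 0 := by exact_mod_cast hN.ne'
  have hev : (trunc (K + 1) (A * B)).eval ((1 : ℝ) / N) =
      (trunc (K + 1) A).eval ((1 : ℝ) / N) * (trunc (K + 1) B).eval ((1 : ℝ) / N)
        - ((1 : ℝ) / N) ^ (K + 1) * Q'.eval ((1 : ℝ) / N) := by
    have h := congrArg (Polynomial.eval ((1 : ℝ) / N)) hQ'
    rw [hQ, Polynomial.eval_sub, Polynomial.eval_mul, Polynomial.eval_mul, Polynomial.eval_pow, Polynomial.eval_X] at h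
    linarith
  have hpow : (N : ℝ) ^ K * ((1 : ℝ) / N) ^ (K + 1) = (1 : ℝ) / N := by
    rw [pow_succ, ← mul_assoc, ← mul_pow, mul_one_div_cancel hN, one_pow, one_mul]
  rw [hev]
  linear_combination (-(Q'.eval ((1 : ℝ) / N))) * hpow

/-- The rescaled sequence converges to the leading coefficient: if `a` has the expansion `A` to order `K` and
`coeff_i A = 0` for `i < n ≤ K`, then `N^n a_N → coeff_n A`. [folklore] -/
theorem tendsto_leading_of_hasExp {K n : ℕ} (hn : n ≤ K) {a : ℕ → ℝ} {A : PowerSeries ℝ}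
    (ha : Tendsto (fun N : ℕ => (N : ℝ) ^ K * (a N - (trunc (K + 1) A).eval ((1 : ℝ) / N))) atTop (𝓝 0))
    (hz : ∀ i, i < n → coeff i A = 0) :
    Tendsto (fun N : ℕ => (N : ℝ) ^ n * a N) atTop (𝓝 (coeff n A)) := by
  obtain ⟨m, rfl⟩ := Nat.exists_eq_add_of_le hn
  have hinv : Tendsto (fun N : ℕ => (1 : ℝ) / N) atTop (𝓝 0) := tendsto_one_div_atTop_nhds_zero_nat
  -- the shifted polynomial part
  have hpoly : Tendsto (fun N : ℕ => ∑ j ∈ Finset.range (m + 1), coeff (n + j) A * ((1 : ℝ) / N) ^ j) atTop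
      (𝓝 (∑ j ∈ Finset.range (m + 1), coeff (n + j) A * (0 : ℝ) ^ j)) :=
    tendsto_finsetSum _ fun j _ => (hinv.pow j).const_mul _
  have hval : (∑ j ∈ Finset.range (m + 1), coeff (n + j) A * (0 : ℝ) ^ j) = coeff n A := by
    rw [Finset.sum_eq_single 0]
    · simp
    · intro j _ hne
      rw [zero_pow hne, mul_zero]
    · intro h; exact absurd (Finset.mem_range.mpr (Nat.succ_pos m)) h
  rw [hval] at hpoly
  -- the remainder part
  have hrem := (hinv.pow m).mul ha
  rw [mul_zero] at hrem
  have h := hpoly.add hrem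
  rw [add_zero] at h
  refine h.congr' ?_
  filter_upwards [eventually_gt_atTop 0] with N hN
  have hN : (N : ℝ) ≠ 0 := by exact_mod_cast hN.ne'
  set y : ℝ := (1 : ℝ) / N with hy
  have hyN : (N : ℝ) * y = 1 := by rw [hy, mul_one_div_cancel hN]
  -- the truncation, split at `n`
  have hT : (trunc (n + m + 1) A).eval y = ∑ j ∈ Finset.range (m + 1), coeff (n + j) A * y ^ (n + j) := by
    rw [eval_trunc_eq_sum, show n + m + 1 = n + (m + 1) by ring, Finset.sum_range_add]
    have hz' : (∑ i ∈ Finset.range n, coeff i A * y ^ i) = 0 :=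
      Finset.sum_eq_zero fun i hi => by rw [hz i (Finset.mem_range.mp hi), zero_mul]
    rw [hz', zero_add]
  have hshift : (N : ℝ) ^ n * (trunc (n + m + 1) A).eval y = ∑ j ∈ Finset.range (m + 1), coeff (n + j) A * y ^ j := by
    rw [hT, Finset.mul_sum]
    refine Finset.sum_congr rfl fun j _ => ?_
    rw [pow_add]
    have : (N : ℝ) ^ n * y ^ n = 1 := by rw [← mul_pow, hyN, one_pow]
    calc (N : ℝ) ^ n * (coeff (n + j) A * (y ^ n * y ^ j)) = ((N : ℝ) ^ n * y ^ n) * (coeff (n + j) A * y ^ j) := by ring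
      _ = coeff (n + j) A * y ^ j := by rw [this, one_mul]
  have hNK : y ^ m * (N : ℝ) ^ (n + m) = (N : ℝ) ^ n := by
    have : y ^ m * (N : ℝ) ^ m = 1 := by rw [← mul_pow, mul_comm, hyN, one_pow]
    rw [pow_add, mul_comm ((N : ℝ) ^ n), ← mul_assoc, this, one_mul]
  calc (∑ j ∈ Finset.range (m + 1), coeff (n + j) A * y ^ j) + y ^ m * ((N : ℝ) ^ (n + m) * (a N - (trunc (n + m + 1) A).eval y))
      = (N : ℝ) ^ n * (trunc (n + m + 1) A).eval y + (y ^ m * (N : ℝ) ^ (n + m)) * (a N - (trunc (n + m + 1) A).eval y) := by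
        rw [hshift]; ring
    _ = (N : ℝ) ^ n * a N := by rw [hNK]; ring

/-! ## The expansion of `φ_N` and of the finite-`N` centered block products -/

/-- The order-`K` clause of the `1/N` expansion, rewritten as an expansion property with coefficient series
`mk c`. [folklore] -/
theorem hasExp_of_expansion {K : ℕ} {a c : ℕ → ℝ}
    (h : Tendsto (fun N : ℕ => (N : ℝ) ^ K * (a N - ∑ i ∈ Finset.range K, c i / (N : ℝ) ^ i)) atTop (𝓝 (c K))) :
    Tendsto (fun N : ℕ => (N : ℝ) ^ K * (a N - (trunc (K + 1) (PowerSeries.mk c)).eval ((1 : ℝ) / N))) atTop (𝓝 0) := by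
  have h' := h.sub (tendsto_const_nhds (x := c K))
  rw [sub_self] at h'
  refine h'.congr' ?_
  filter_upwards [eventually_gt_atTop 0] with N hN
  have hN : (N : ℝ) ≠ 0 := by exact_mod_cast hN.ne'
  rw [eval_trunc_eq_sum, Finset.sum_range_succ]
  simp only [coeff_mk, one_div_pow]
  have h1 : (N : ℝ) ^ K * (c K * (1 / (N : ℝ) ^ K)) = c K := by field_simp
  have h2 : ∀ i ∈ Finset.range K, c i * (1 / (N : ℝ) ^ i) = c i / (N : ℝ) ^ i := fun i _ => by rw [mul_one_div]
  rw [Finset.sum_congr rfl h2]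
  linear_combination h1

/-- ★ The finite-`N` centered block products `G_N(B₀; C₁, …, C_m)` (first-block recursion with `p = p_N`, e.g.
`p_N = φ_{Λ_N,N,β}`) have the `1/N` expansion given by the power-series centered block products `G(B₀; C₁, …, C_m)`
(same recursion with `p = P`), to every order `K` to which `p_N(u)` expands with coefficient series `P(u)` on genuine
loop sequences. [new (lane)] -/
theorem centered_hasExp {K : ℕ} {pN : ℕ → LoopSeq d → ℝ} {P : LoopSeq d → PowerSeries ℝ}
    (hexp : ∀ u : LoopSeq d, IsLoopSeq u →
      Tendsto (fun N : ℕ => (N : ℝ) ^ K * (pN N u - (trunc (K + 1) (P u)).eval ((1 : ℝ) / N))) atTop (𝓝 0))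
    {GN : ℕ → LoopSeq d → List (LoopSeq d) → ℝ} (hGN0 : ∀ (N : ℕ) (B₀ : LoopSeq d), GN N B₀ [] = pN N B₀)
    (hGNs : ∀ (N : ℕ) (B₀ C : LoopSeq d) (rest : List (LoopSeq d)),
      GN N B₀ (C :: rest) = GN N (B₀ ++ C) rest - pN N C * GN N B₀ rest)
    {G : LoopSeq d → List (LoopSeq d) → PowerSeries ℝ} (hG0 : ∀ B₀ : LoopSeq d, G B₀ [] = P B₀)
    (hGs : ∀ (B₀ C : LoopSeq d) (rest : List (LoopSeq d)), G B₀ (C :: rest) = G (B₀ ++ C) rest - P C * G B₀ rest) :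
    ∀ (Cs : List (LoopSeq d)) (B₀ : LoopSeq d), IsLoopSeq B₀ → (∀ C ∈ Cs, IsLoopSeq C) →
      Tendsto (fun N : ℕ => (N : ℝ) ^ K * (GN N B₀ Cs - (trunc (K + 1) (G B₀ Cs)).eval ((1 : ℝ) / N))) atTop (𝓝 0) := by
  intro Cs
  induction Cs with
  | nil =>
    intro B₀ hB₀ _
    simp only [hGN0, hG0]
    exact hexp B₀ hB₀
  | cons C rest ih =>
    intro B₀ hB₀ hCs
    have hC : IsLoopSeq C := hCs C (by simp)
    have hrest : ∀ C' ∈ rest, IsLoopSeq C' := fun C' hC' => hCs C' (by simp [hC'])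
    simp only [hGNs, hGs]
    exact hasExp_sub (ih (B₀ ++ C) (isLoopSeq_append hB₀ hC) hrest) (hasExp_mul (hexp C hC) (ih B₀ hB₀ hrest))

/-- ★ Consequently, when the coefficients of `G(B₀; C₁, …, C_m)` vanish below order `m ≤ K`, the rescaled centered
product converges: `N^m G_N(B₀; C₁, …, C_m) → coeff_m G(B₀; C₁, …, C_m)`. [new (lane)] -/
theorem centered_tendsto_leading {K : ℕ} {pN : ℕ → LoopSeq d → ℝ} {P : LoopSeq d → PowerSeries ℝ}
    (hexp : ∀ u : LoopSeq d, IsLoopSeq u →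
      Tendsto (fun N : ℕ => (N : ℝ) ^ K * (pN N u - (trunc (K + 1) (P u)).eval ((1 : ℝ) / N))) atTop (𝓝 0))
    {GN : ℕ → LoopSeq d → List (LoopSeq d) → ℝ} (hGN0 : ∀ (N : ℕ) (B₀ : LoopSeq d), GN N B₀ [] = pN N B₀)
    (hGNs : ∀ (N : ℕ) (B₀ C : LoopSeq d) (rest : List (LoopSeq d)),
      GN N B₀ (C :: rest) = GN N (B₀ ++ C) rest - pN N C * GN N B₀ rest)
    {G : LoopSeq d → List (LoopSeq d) → PowerSeries ℝ} (hG0 : ∀ B₀ : LoopSeq d, G B₀ [] = P B₀)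
    (hGs : ∀ (B₀ C : LoopSeq d) (rest : List (LoopSeq d)), G B₀ (C :: rest) = G (B₀ ++ C) rest - P C * G B₀ rest)
    (hvan : ∀ k, k ≤ K → ∀ (B₀ : LoopSeq d) (Cs : List (LoopSeq d)), IsLoopSeq B₀ → (∀ C ∈ Cs, IsLoopSeq C) →
      k < Cs.length → coeff k (G B₀ Cs) = 0)
    (B₀ : LoopSeq d) (Cs : List (LoopSeq d)) (hB₀ : IsLoopSeq B₀) (hCs : ∀ C ∈ Cs, IsLoopSeq C) (hlen : Cs.length ≤ K) :
    Tendsto (fun N : ℕ => (N : ℝ) ^ Cs.length * GN N B₀ Cs) atTop (𝓝 (coeff Cs.length (G B₀ Cs))) :=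
  tendsto_leading_of_hasExp hlen (centered_hasExp hexp hGN0 hGNs hG0 hGs Cs B₀ hB₀ hCs)
    fun i hi => hvan i (by omega) B₀ Cs hB₀ hCs hi

end StringDuality

end Summit.QuantumFields.GaugeBoot

end
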